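import Literature.NumberTheory.EllipticCurves.InertiaFixedTorsionOfTamagawaProofs
import Literature.NumberTheory.EllipticCurves.KodairaNeronUnramifiedMultiplicativeBoundProofs
import Literature.NumberTheory.EllipticCurves.MultiplicativeTransvectionPrimeToVProofs
import Literature.NumberTheory.EllipticCurves.HeegnerPointsKolyvaginPairing
import Literature.NumberTheory.EllipticCurves.NeronOggShafarevichLocal
import Literature.NumberTheory.EllipticCurves.GeomPointsGaloisModule
import Literature.NumberTheory.EllipticCurves.KummerSelmerStructure
import HarnessLib

/-!
# Route `GenusKolyvaginAtTwo`, crux L_T `PowDvdShaCardAtTwoRT` (stmt-BirchSwinnertonDyer-23242), LINE 18 stub L, bottom rung: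
# the NON-PHANTOM lemma (IV) — at a multiplicative place `v ∤ n` with `gcd(n, ord_v Δ) = 1`, `E(K_v^nr)` is
# `n`-divisible, a Kummer class is principal on the inertia group, and the inertia group contains a transvection

Seat `bsd-line-gk2-p3` g22 (PROVER 3/3, cell `bsd-f1-sign2`), `--supports stmt-BirchSwinnertonDyer-23242` (helper).
THEOREMS ONLY (no definition, no named fact, no `sorry`). BSD is not proved by any of this; neither is the crux.

This is the LOCAL INPUT of the non-phantom lemma (files `…RTNonPhantomCocycleBasis`, `…RTNonPhantomTwoTorsionValues`,
`…RTNonPhantomCoboundary`): the algebra there kills a phantom class of `H¹(K, E[4])` as soon as its cocycle is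
PRINCIPAL ON ONE TRANSVECTION `u = (1 1; 0 1)`.  Here both are supplied by a place `v` of MULTIPLICATIVE reduction with
`v ∤ 2` and `ord_v Δ_min` ODD (on the route's habitat every multiplicative prime has odd `ord_p Δ`, since `c_p` is odd):

* `exists_forall_inertia_nsmul_eq_of_hasMultiplicativeReductionAt` — **`E(K_v^{nr})` is `n`-divisible** for `n` a unit at
  `v` with `gcd(n, ord_v Δ_min) = 1` (model currency, `V = (M ⊗ K_v) ⊗ K̄_v`, `M` the integral minimal model): Kodaira–Néron
  over `K_v^{nr}` (`[E(K_v^{nr}) : E₀] = ord_v Δ`, tree `ordΔ_nsmul_reducesToNonsingular_of_hasMultiplicativeReduction`),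
  `E₀(K_v^{nr})` `n`-divisible (tree `exists_nsmul_eq_of_reducesToNonsingular_of_forall_inertia`) and Bézout;
* `exists_absInertia_nsmul_eq_localPoints_of_hasMultiplicativeReductionAt` — the same for `E(K̄_v) = localPoints`;
* `exists_h1Eval_resGal_eq_of_mem_selmerLocalKer` — **a class of `H¹(K, E[n])` satisfying the local Kummer (Selmer)
  condition at such a `v` is PRINCIPAL on the inertia group**: `[x, res τ] = (res τ) m − m` for every `τ ∈ I_v`
  (Silverman's proof of *AEC* X.4.2 (b) at a bad place: the Kummer point `P`, `nP ∈ E(K_v)`, differs from an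
  `I_v`-fixed `n`-th root by an `n`-torsion point);
* `exists_absInertia_unipotent_of_hasMultiplicativeReductionAt` — the Tate transvection WITH ITS PROVENANCE: some
  `τ ∈ I_v` acts on `E[p^k]` with `(τ − 1)² = 0` and moves `E[p]` when `p ∤ ord_v Δ_min` (tree
  `exists_unipotent_of_hasMultiplicativeReductionAt`, which forgets that `σ = res τ`).

References: [SilvermanAEC2009] Thm. VII.6.1, Cor. VII.6.2, proof of Thm. X.4.2 (b); [SilvermanATAEC1994] Cor. IV.9.2 (d),
V.4–V.5 and Exercise 5.13 (b); [SerreAbelianLadic1968] Ch. IV, A.1.2; [GreenbergLNM1716] §2.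
-/

-- `Summit.<P>.<Sub>` repeats `BirchSwinnertonDyer` by the tree's layout convention (D-0017)
set_option linter.dupNamespace false
set_option autoImplicit false

noncomputable section

open scoped Classical NNReal
open NumberField IsDedekindDomain Field

universe u

namespace Summit.BirchSwinnertonDyer.BirchSwinnertonDyer.Theorems.GenusExact.NonPhantom

open WeierstrassCurve Literature.NumberTheory.EllipticCurves Literature.NumberTheory.GaloisRepresentations
  IsDedekindDomain.HeightOneSpectrum
  Literature.NumberTheory.GaloisRepresentations.IsNonarchimedeanLocalField

variable {K : Type u} [Field K] [NumberField K] (W : WeierstrassCurve K) {v : HeightOneSpectrum (𝓞 K)}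
  {w : Valuation (AlgebraicClosure (v.adicCompletion K)) ℝ≥0}
  (hw : ∀ x, (w x : ℝ) = spectralNorm (v.adicCompletion K) (AlgebraicClosure (v.adicCompletion K)) x)

/-! ## §1 `E(K_v^{nr})` is `n`-divisible at a multiplicative place with `gcd(n, ord_v Δ) = 1` -/

include hw in
set_option maxHeartbeats 1600000 in
/-- **`E(K_v^{nr})` is `n`-divisible at a multiplicative place when `n` is a unit at `v` and `gcd(n, ord_v Δ_min) = 1`**
(model currency).  `M = W.localMinimalIntegralModel v`, `V = (M ⊗ K_v) ⊗ K̄_v`, `𝔐` the prime of `\bar 𝓞_v` above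
`𝓂_v`: every `I_𝔐`-fixed `R ∈ V(K̄_v)` is `n • Q` for an `I_𝔐`-fixed `Q`.  Proof: `N • R ∈ E₀` for `N = ord_v Δ_min`
(Kodaira–Néron over `K_v^{nr}`), `N • R = n • Q₀` with `Q₀ ∈ E₀(K_v^{nr})` (divisibility of `E₀(K_v^{nr})`), and
`1 = a n + b N` gives `R = n • (a • R + b • Q₀)`.
[cite: SilvermanAEC2009, Thm. VII.6.1 and Cor. VII.6.2 (PDF p. 177)] [cite: SilvermanATAEC1994, Cor. IV.9.2 (d)] -/
theorem exists_forall_inertia_nsmul_eq_of_hasMultiplicativeReductionAt [W.IsElliptic]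
    (hmult : W.HasMultiplicativeReductionAt v) {𝔐 : Ideal v.localAbsIntegers} (h𝔐 : 𝔐 ∈ v.localPrimesAbove)
    {n : ℕ} (hn : IsUnit ((n : ℕ) : v.adicCompletionIntegers K)) (hcop : n.Coprime (W.ordMinimalDiscriminant v))
    {R : (((W.localMinimalIntegralModel v).map (algebraMap (v.adicCompletionIntegers K)
        (v.adicCompletion K))).baseChange (AlgebraicClosure (v.adicCompletion K))).toAffine.Point}
    (hRI : ∀ τ ∈ 𝔐.inertia (absoluteGaloisGroup (v.adicCompletion K)),
      Affine.Point.map ((absoluteGaloisGroup.toAlgEquiv (v.adicCompletion K) τ :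
          AlgebraicClosure (v.adicCompletion K) ≃ₐ[v.adicCompletion K] AlgebraicClosure (v.adicCompletion K)) :
          AlgebraicClosure (v.adicCompletion K) →ₐ[v.adicCompletion K] AlgebraicClosure (v.adicCompletion K)) R = R) :
    ∃ Q : (((W.localMinimalIntegralModel v).map (algebraMap (v.adicCompletionIntegers K)
        (v.adicCompletion K))).baseChange (AlgebraicClosure (v.adicCompletion K))).toAffine.Point,
      (∀ τ ∈ 𝔐.inertia (absoluteGaloisGroup (v.adicCompletion K)),
        Affine.Point.map ((absoluteGaloisGroup.toAlgEquiv (v.adicCompletion K) τ :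
            AlgebraicClosure (v.adicCompletion K) ≃ₐ[v.adicCompletion K] AlgebraicClosure (v.adicCompletion K)) :
            AlgebraicClosure (v.adicCompletion K) →ₐ[v.adicCompletion K] AlgebraicClosure (v.adicCompletion K)) Q = Q) ∧
      n • Q = R := by
  haveI hV := isIntegral_spectralValuation_baseChange hw (W.localMinimalIntegralModel v)
  haveI := W.isElliptic_map_localMinimalIntegralModel (v := v)
  -- `X = M ⊗ K_v` is the chosen minimal model, so it has multiplicative reduction
  have hX : (W.localMinimalIntegralModel v).map (algebraMap (v.adicCompletionIntegers K) (v.adicCompletion K)) =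
      W.localMinimalModel v :=
    baseChange_integralModel_eq (v.adicCompletionIntegers K) (W.localMinimalModel v)
  have hmultX : ((W.localMinimalIntegralModel v).map (algebraMap (v.adicCompletionIntegers K)
      (v.adicCompletion K))).HasMultiplicativeReduction (v.adicCompletionIntegers K) := by
    rw [hX]; exact hmult
  -- Kodaira–Néron: `N • R ∈ E₀`, `N = ord Δ (X.integralModel) = ord_v Δ_min`
  obtain ⟨-, hKN⟩ := ((W.localMinimalIntegralModel v).map (algebraMap (v.adicCompletionIntegers K)
    (v.adicCompletion K))).ordΔ_nsmul_reducesToNonsingular_of_hasMultiplicativeReduction hmultX w hw h𝔐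
  have hΔ : (((W.localMinimalIntegralModel v).map (algebraMap (v.adicCompletionIntegers K)
      (v.adicCompletion K))).integralModel (v.adicCompletionIntegers K)).Δ = (W.localMinimalIntegralModel v).Δ := by
    apply IsFractionRing.injective (v.adicCompletionIntegers K) (v.adicCompletion K)
    rw [integralModel_Δ_eq, map_Δ]
  have hN : (IsDiscreteValuationRing.addVal (v.adicCompletionIntegers K)
      (((W.localMinimalIntegralModel v).map (algebraMap (v.adicCompletionIntegers K)
      (v.adicCompletion K))).integralModel (v.adicCompletionIntegers K)).Δ).toNat = W.ordMinimalDiscriminant v := by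
    rw [hΔ]; rfl
  rw [hN] at hKN
  have hNR := hKN R hRI
  -- divide `N • R ∈ E₀(K_v^{nr})` by `n`
  have hbad : ¬ W.HasGoodReductionAt v := hmult.not_hasGoodReductionAt
  have hNRI : ∀ τ ∈ 𝔐.inertia (absoluteGaloisGroup (v.adicCompletion K)),
      Affine.Point.map ((absoluteGaloisGroup.toAlgEquiv (v.adicCompletion K) τ :
          AlgebraicClosure (v.adicCompletion K) ≃ₐ[v.adicCompletion K] AlgebraicClosure (v.adicCompletion K)) :
          AlgebraicClosure (v.adicCompletion K) →ₐ[v.adicCompletion K] AlgebraicClosure (v.adicCompletion K))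
        (W.ordMinimalDiscriminant v • R) = W.ordMinimalDiscriminant v • R := fun τ hτ ↦ by
    rw [map_nsmul, hRI τ hτ]
  obtain ⟨Q₀, -, hQ₀I, hQ₀⟩ :=
    W.exists_nsmul_eq_of_reducesToNonsingular_of_forall_inertia hw h𝔐 hbad hn hNR hNRI
  -- Bézout: `1 = n a + N b`
  have hbez : (n : ℤ) * Nat.gcdA n (W.ordMinimalDiscriminant v) +
      (W.ordMinimalDiscriminant v : ℤ) * Nat.gcdB n (W.ordMinimalDiscriminant v) = 1 := by
    rw [← Nat.gcd_eq_gcd_ab, Nat.Coprime.gcd_eq_one hcop, Nat.cast_one]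
  refine ⟨Nat.gcdA n (W.ordMinimalDiscriminant v) • R + Nat.gcdB n (W.ordMinimalDiscriminant v) • Q₀,
    fun τ hτ ↦ by rw [map_add, map_zsmul, map_zsmul, hRI τ hτ, hQ₀I τ hτ], ?_⟩
  have hQ₀' : (n : ℤ) • Q₀ = (W.ordMinimalDiscriminant v : ℤ) • R := by
    rw [natCast_zsmul, natCast_zsmul, hQ₀]
  rw [← natCast_zsmul]
  calc (n : ℤ) • (Nat.gcdA n (W.ordMinimalDiscriminant v) • R + Nat.gcdB n (W.ordMinimalDiscriminant v) • Q₀)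
      = ((n : ℤ) * Nat.gcdA n (W.ordMinimalDiscriminant v)) • R +
          Nat.gcdB n (W.ordMinimalDiscriminant v) • ((n : ℤ) • Q₀) := by module
    _ = ((n : ℤ) * Nat.gcdA n (W.ordMinimalDiscriminant v)) • R +
          Nat.gcdB n (W.ordMinimalDiscriminant v) • ((W.ordMinimalDiscriminant v : ℤ) • R) := by rw [hQ₀']
    _ = ((n : ℤ) * Nat.gcdA n (W.ordMinimalDiscriminant v) +
          (W.ordMinimalDiscriminant v : ℤ) * Nat.gcdB n (W.ordMinimalDiscriminant v)) • R := by module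
    _ = R := by rw [hbez, one_smul]

/-! ## §2 The same on `E(K̄_v) = localPoints W K_v` -/

omit hw in
/-- `congrEquiv` along `X₁ = X₂` commutes with the Galois action on `K̄_v`-points. [folklore] -/
private theorem congrEquiv_map_comm {F : Type*} [Field F] {L : Type*} [Field L] [Algebra F L]
    {X₁ X₂ : WeierstrassCurve F} (h : X₁ = X₂) (h' : X₁.baseChange L = X₂.baseChange L)
    (σ : L →ₐ[F] L) (P : (X₁.baseChange L).toAffine.Point) :
    Affine.Point.congrEquiv h' (Affine.Point.map (W' := X₁) σ P) =
      Affine.Point.map (W' := X₂) σ (Affine.Point.congrEquiv h' P) := by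
  subst h; rfl

/-- **`E(K_v^{nr})` is `n`-divisible, `localPoints` currency.**  For `E/K` with multiplicative reduction at `v`, `n` a unit at
`v` with `gcd(n, ord_v Δ_min) = 1`: every `R ∈ E(K̄_v)` fixed by the inertia group `absInertia K_v` is `n • Q` for an
inertia-fixed `Q` (transport of §1 along `E(K̄_v) ≃ X(K̄_v) ≃ V(K̄_v)`).
[cite: SilvermanAEC2009, Thm. VII.6.1 and Cor. VII.6.2 (PDF p. 177)] [cite: SilvermanATAEC1994, Cor. IV.9.2 (d)] -/
theorem exists_absInertia_nsmul_eq_localPoints_of_hasMultiplicativeReductionAt [W.IsElliptic]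
    (hmult : W.HasMultiplicativeReductionAt v) {n : ℕ} (hn : IsUnit ((n : ℕ) : v.adicCompletionIntegers K))
    (hcop : n.Coprime (W.ordMinimalDiscriminant v)) {R : localPoints W (v.adicCompletion K)}
    (hRI : ∀ σ ∈ absInertia (v.adicCompletion K), σ • R = R) :
    ∃ Q : localPoints W (v.adicCompletion K), (∀ σ ∈ absInertia (v.adicCompletion K), σ • Q = Q) ∧ n • Q = R := by
  obtain ⟨w, hw⟩ := v.exists_spectralValuation
  obtain ⟨𝔐, h𝔐⟩ := v.localPrimesAbove_nonempty
  have hX₀K : (W.localMinimalIntegralModel v).map (algebraMap (v.adicCompletionIntegers K) (v.adicCompletion K)) =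
      W.localMinimalModel v :=
    baseChange_integralModel_eq (v.adicCompletionIntegers K) (W.localMinimalModel v)
  have hVX : ((W.localMinimalIntegralModel v).map (algebraMap (v.adicCompletionIntegers K)
      (v.adicCompletion K))).baseChange (AlgebraicClosure (v.adicCompletion K)) =
      (W.localMinimalModel v).baseChange (AlgebraicClosure (v.adicCompletion K)) := by
    rw [hX₀K]
  obtain ⟨C, hC⟩ := W.exists_variableChange_smul_eq_localMinimalModel v
  obtain ⟨Φ, hΦ⟩ := W.exists_addEquiv_localPoints_of_smul_eq v hC
  -- the point read on `V = (M ⊗ K_v) ⊗ K̄_v`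
  have hR₂I : ∀ τ ∈ 𝔐.inertia (absoluteGaloisGroup (v.adicCompletion K)),
      Affine.Point.map ((absoluteGaloisGroup.toAlgEquiv (v.adicCompletion K) τ :
          AlgebraicClosure (v.adicCompletion K) ≃ₐ[v.adicCompletion K] AlgebraicClosure (v.adicCompletion K)) :
          AlgebraicClosure (v.adicCompletion K) →ₐ[v.adicCompletion K] AlgebraicClosure (v.adicCompletion K))
        ((Affine.Point.congrEquiv hVX).symm (Φ R)) = (Affine.Point.congrEquiv hVX).symm (Φ R) := by
    intro τ hτ
    have hτ' : τ ∈ absInertia (v.adicCompletion K) := by rwa [inertia_eq_absInertia hw h𝔐] at hτ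
    apply (Affine.Point.congrEquiv hVX).injective
    rw [congrEquiv_map_comm hX₀K hVX, AddEquiv.apply_symm_apply, ← hΦ, hRI τ hτ']
  obtain ⟨Q₂, hQ₂I, hQ₂⟩ :=
    exists_forall_inertia_nsmul_eq_of_hasMultiplicativeReductionAt W hw hmult h𝔐 hn hcop hR₂I
  refine ⟨Φ.symm (Affine.Point.congrEquiv hVX Q₂), fun σ hσ ↦ ?_, ?_⟩
  · have hσ' : σ ∈ 𝔐.inertia (absoluteGaloisGroup (v.adicCompletion K)) := by
      rw [inertia_eq_absInertia hw h𝔐]; exact hσ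
    apply Φ.injective
    rw [hΦ, AddEquiv.apply_symm_apply, ← congrEquiv_map_comm hX₀K hVX, hQ₂I σ hσ']
  · apply Φ.injective
    rw [map_nsmul, AddEquiv.apply_symm_apply, ← map_nsmul, hQ₂, AddEquiv.apply_symm_apply]

/-! ## §3 A Kummer class is principal on the inertia group of such a place -/

omit hw in
/-- **Local Kummer condition ⟹ principal on inertia** at a multiplicative place `v ∤ n` with `gcd(n, ord_v Δ_min) = 1`.
For `x ∈ H¹(K, E[n])` in the local kernel `selmerLocalKer W K_v n` (its image in `H¹(K_v, E)` vanishes) and `τ` in the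
inertia group `absInertia K_v`: `[x, res τ] = (res τ) • m − m` for some `m ∈ E[n]` — the chosen cocycle of `x` is a
coboundary on `τ`.  Proof (Silverman's argument for *AEC* X.4.2 (b), at a bad place): the cocycle is `σ ↦ σP − P` on
`Γ_{K_v}` with `nP ∈ E(K_v)`; by §2, `nP = nQ` with `Q` inertia-fixed, and `m = P − Q ∈ E[n]`.
[cite: SilvermanAEC2009, X.§4 proof of Thm. 4.2 (b) and Cor. 4.4] [cite: SilvermanATAEC1994, Cor. IV.9.2 (d)] -/
theorem exists_h1Eval_resGal_eq_of_mem_selmerLocalKer [W.IsElliptic] (hmult : W.HasMultiplicativeReductionAt v)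
    {n : ℕ} (hn0 : n ≠ 0) (hn : IsUnit ((n : ℕ) : v.adicCompletionIntegers K))
    (hcop : n.Coprime (W.ordMinimalDiscriminant v))
    {x : galH1Torsion W (n : ℤ)} (hx : x ∈ selmerLocalKer W (v.adicCompletion K) (n : ℤ))
    {τ : absoluteGaloisGroup (v.adicCompletion K)} (hτ : τ ∈ absInertia (v.adicCompletion K)) :
    ∃ m : geomTorsion W (n : ℤ), h1Eval W (n : ℤ) x (resGal (K := K) (v.adicCompletion K) τ) =
      resGal (K := K) (v.adicCompletion K) τ • m - m := by
  -- the chosen cocycle of `x` and its local Kummer point `P`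
  have hx' : oneCocycleClass _ (reprCocycle W (n : ℤ) x) ∈ selmerLocalKer W (v.adicCompletion K) (n : ℤ) := by
    rwa [oneCocycleClass_reprCocycle]
  obtain ⟨P, hP⟩ := (oneCocycleClass_mem_resKer_iff _ _ _ (reprCocycle W (n : ℤ) x)).mp hx'
  have hP' : ∀ σ : absoluteGaloisGroup (v.adicCompletion K),
      pointsMap W (v.adicCompletion K)
        (((reprCocycle W (n : ℤ) x).1 (resGal (K := K) (v.adicCompletion K) σ) : geomTorsion W (n : ℤ)) :
          geomPoints W) = σ • P - P := fun σ ↦ hP σ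
  -- `n • P` is `Γ_{K_v}`-fixed
  have hnP : ∀ σ : absoluteGaloisGroup (v.adicCompletion K), σ • (n • P) = n • P := by
    intro σ
    have h0 : ((n : ℤ) • (((reprCocycle W (n : ℤ) x).1 (resGal (K := K) (v.adicCompletion K) σ) :
        geomTorsion W (n : ℤ)) : geomPoints W)) = 0 :=
      (Submodule.mem_torsionBy_iff (n : ℤ) _).mp ((reprCocycle W (n : ℤ) x).1 _).2
    have h1 : (n : ℤ) • (σ • P - P) = 0 := by rw [← hP' σ, ← map_zsmul, h0, map_zero]
    rw [zsmul_sub, ← smul_zsmul_localPoints, sub_eq_zero, natCast_zsmul] at h1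
    exact h1
  obtain ⟨Q, hQI, hQ⟩ := exists_absInertia_nsmul_eq_localPoints_of_hasMultiplicativeReductionAt W hmult hn hcop
    (R := n • P) (fun σ _ ↦ hnP σ)
  -- `m = P − Q ∈ E[n]` comes from `E(K̄)`
  have hm' : n • (P - Q) = 0 := by rw [nsmul_sub, hQ, sub_self]
  obtain ⟨m₀, hm₀n, hm₀⟩ :=
    exists_pointsMapOfEmb_eq_of_nsmul_eq_zero W (closureEmb (K := K) (v.adicCompletion K)) hn0 hm'
  refine ⟨⟨m₀, (mem_geomTorsion_iff W (n : ℤ) m₀).mpr (by rw [natCast_zsmul, hm₀n])⟩, Subtype.ext ?_⟩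
  apply pointsMapOfEmb_injective W (closureEmb (K := K) (v.adicCompletion K))
  change pointsMap W (v.adicCompletion K)
      (((reprCocycle W (n : ℤ) x).1 (resGal (K := K) (v.adicCompletion K) τ) : geomTorsion W (n : ℤ)) :
        geomPoints W) =
    pointsMap W (v.adicCompletion K) _
  rw [hP' τ, AddSubgroupClass.coe_sub, Literature.NumberTheory.EllipticCurves.AddSubgroup.torsionBy.coe_smul,
    map_sub, pointsMap_smul]
  change τ • P - P = τ • pointsMapOfEmb W (closureEmb (K := K) (v.adicCompletion K)) m₀ -
    pointsMapOfEmb W (closureEmb (K := K) (v.adicCompletion K)) m₀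
  rw [hm₀, smul_sub, hQI τ hτ]
  abel

/-! ## §4 The Tate transvection, with its inertial provenance -/

omit hw in
/-- **A unipotent inertia element moving `E[p]`** at a place `v ∤ p` of multiplicative reduction with `p ∤ ord_v Δ_min`:
some `τ` of the inertia group `absInertia K_v` acts on `E[p^k]` (`k ≥ 1`) through `σ = res τ ∈ Γ_K` with
`σ (σ P − P) = σ P − P` and moves some `Q ∈ E[p^k]` with `p Q = O` — the tree's
`exists_unipotent_of_hasMultiplicativeReductionAt` (Tate: inertia acts through `(1 ord_v q; 0 1)`), keeping track of
the inertial provenance `σ = res τ` that the non-phantom lemma needs.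
[cite: SilvermanATAEC1994, V.4–V.5 and Exercise 5.13 (b) (PDF p. 416)] [cite: SerreAbelianLadic1968, Ch. IV, A.1.2] -/
theorem exists_absInertia_unipotent_of_hasMultiplicativeReductionAt [W.IsElliptic]
    (hmult : W.HasMultiplicativeReductionAt v) {p : ℕ} (hp : p.Prime) (hpv : (p : 𝓞 K) ∉ v.asIdeal)
    (hndvd : ¬ p ∣ W.ordMinimalDiscriminant v) {k : ℕ} (hk : 1 ≤ k) {N : ℤ} (hN : N = ((p ^ k : ℕ) : ℤ)) :
    ∃ τ ∈ absInertia (v.adicCompletion K),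
      (∀ P : geomTorsion W N, resGal (K := K) (v.adicCompletion K) τ •
          (resGal (K := K) (v.adicCompletion K) τ • P - P) = resGal (K := K) (v.adicCompletion K) τ • P - P) ∧
      ∃ Q : geomTorsion W N, p • Q = 0 ∧ resGal (K := K) (v.adicCompletion K) τ • Q ≠ Q := by
  subst hN
  obtain ⟨w, hw⟩ := v.exists_spectralValuation
  obtain ⟨𝔐, h𝔐⟩ := v.localPrimesAbove_nonempty
  obtain ⟨τ, hτ, Q, hpQ, hτQ⟩ :=
    W.exists_inertia_smul_ne_of_hasMultiplicativeReductionAt_of_not_dvd hmult hp hpv hndvd hw h𝔐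
  have hinj : Function.Injective (pointsMap W (v.adicCompletion K)) := pointsMapOfEmb_injective W _
  refine ⟨τ, by rw [← inertia_eq_absInertia hw h𝔐]; exact hτ, fun P ↦ ?_, ?_⟩
  · -- `(σ - 1)² = 0` on `E[p^k]`, read in `E(K̄_v)`
    have hP' : p ^ k • pointsMap W (v.adicCompletion K) (P : geomPoints W) = 0 := by
      rw [← map_nsmul, ← natCast_zsmul]
      have h2 : ((p ^ k : ℕ) : ℤ) • (P : geomPoints W) = 0 := (Submodule.mem_torsionBy_iff _ _).mp P.2
      rw [h2, map_zero]
    have key := W.smul_smul_sub_eq_of_mem_inertia_of_hasMultiplicativeReductionAt hmult hp hpv hk hw h𝔐 hτ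
      (pointsMap W (v.adicCompletion K) (P : geomPoints W)) hP'
    apply Subtype.ext
    simp only [AddSubgroupClass.coe_sub, Literature.NumberTheory.EllipticCurves.AddSubgroup.torsionBy.coe_smul]
    apply hinj
    simp only [map_sub, pointsMap_smul]
    exact key
  · -- the moved `p`-torsion point comes from `E(K̄)`
    obtain ⟨P₀, hpP₀, hP₀Q⟩ := exists_pointsMapOfEmb_eq_of_nsmul_eq_zero W
      (closureEmb (K := K) (v.adicCompletion K)) hp.ne_zero hpQ
    have hmem : P₀ ∈ geomTorsion W ((p ^ k : ℕ) : ℤ) := by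
      refine (Submodule.mem_torsionBy_iff _ _).mpr ?_
      change ((p ^ k : ℕ) : ℤ) • P₀ = 0
      obtain ⟨j, rfl⟩ : ∃ j, k = j + 1 := ⟨k - 1, by omega⟩
      rw [natCast_zsmul, pow_succ, mul_nsmul, smul_comm, hpP₀, smul_zero]
    refine ⟨⟨P₀, hmem⟩, Subtype.ext ?_, fun h ↦ hτQ ?_⟩
    · simpa only [AddSubmonoidClass.coe_nsmul, ZeroMemClass.coe_zero] using hpP₀
    · have h' := congrArg
        (fun R : geomTorsion W ((p ^ k : ℕ) : ℤ) ↦ pointsMap W (v.adicCompletion K) (R : geomPoints W)) h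
      simp only [Literature.NumberTheory.EllipticCurves.AddSubgroup.torsionBy.coe_smul, pointsMap_smul] at h'
      rw [← hP₀Q]
      exact h'

end Summit.BirchSwinnertonDyer.BirchSwinnertonDyer.Theorems.GenusExact.NonPhantom

end
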